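import Literature.AlgebraicGeometry.HodgeTheory.Sl2IsotypicTimesCMProductSpan
import Literature.AlgebraicGeometry.HodgeTheory.FiniteProductsMixedPowersRetract
import Literature.AlgebraicGeometry.HodgeTheory.MixedEllipticCurvesProductsHodgeClasses
import HarnessLib

/-!
# `B = D` on `B × Z` for `B` with slots over a non-CM `A` of Hodge-group rank three and `Z` with slots over `C` of CM type:
# Moonen–Zarhin 1999 Thm. (3.2)(2) PROVED for the `𝔰𝔩₂`-isotypic class; `A × E` (`E` a CM elliptic curve) is stably nondegenerate

Family `hodge`, layer `Literature/AlgebraicGeometry/HodgeTheory`.  Written for the cell `pub-hodgecm2` (COR-CM), seat `b27` gen 35,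
count-neutral lane MT-RANK-FIVE-DIVISORS (sequel of `Sl2IsotypicTimesCMProductSpan`, gen 34, and `Sl2IsotypicDivisorClasses`, gen 31).
UNCONDITIONAL; theorems only, no definition, no named fact (D-0026); nothing here uses or asserts HC_CM.

PUBLISHED STATEMENT.  Moonen–Zarhin, *Hodge classes on abelian varieties of low dimension*, Math. Ann. 315 (1999), §3
Thm. (3.2) (after Hazama): «Let `X₁` and `X₂` be complex abelian varieties which both satisfy condition (D) [`B•(Xⁿ) = D•(Xⁿ)`
for all `n`]. … (2) Suppose `X₁` has no factors of Type 4 and `X₂` is of CM-type.  Then `X₁ × X₂` again satisfies (D) and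
`Hg(X₁ × X₂) = Hg(X₁) × Hg(X₂)`.»; §3 first paragraph: `Hg(X₁ × X₂) = Hg(X₁) × Hg(X₂)` holds iff for all `m`, `n` the Hodge
ring `B•(X₁^m × X₂^n)` is generated by the elements coming from `B•(X₁^m)` and `B•(X₂^n)`; (3.8)–(3.9) (`X × E`).

THIS FILE (tree statements).
* §1 **`isDivisorGenerated_prod_of_productSpan`** — for ANY complex abelian varieties `A`, `C`: if the Hodge classes of `A × C`
  are spanned by exterior products of Hodge classes (`HodgeClassesProductSpan A C`) and `B(A) = D(A)`, `B(C) = D(C)`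
  (`IsDivisorGenerated`), then `B(A × C) = D(A × C)` — the exterior product `pr_A^* a ⌣ pr_C^* b` of divisor polynomials is a
  divisor polynomial (`map_mem_divisorClassesSpan`, `cupProduct_mem_divisorClassesSpan_of_mem`);
  `isDivisorGenerated_powSucc_prod_of_isDivisorGenerated_prod_powSucc` — `(A × C)^{N+1}` is a retract of `A^{N+1} × C^{N+1}`;
  **`isStablyNondegenerate_prod_of_forall_productSpan_powSucc`** — if every `B(A^{N+1} × C^{N+1})` is spanned by exterior
  products and `A`, `C` satisfy (D), then `A × C` satisfies (D) (Moonen–Zarhin §3, first paragraph + (3.2)).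
* §2 **`AVSlots.isDivisorGenerated_prod_of_finrank_hodgeLie_le_three_of_isOfCMType`** — Moonen–Zarhin Thm. (3.2)(2) PROVED for
  the `𝔰𝔩₂`-isotypic class: `B` with `n` slots over a complex abelian variety `A` NOT of CM type with `dim_ℚ Lie Hg(H¹A) ≤ 3`
  (non-CM elliptic curves, abelian surfaces with quaternionic multiplication), `Z` with `n` slots over `C` of CM type,
  `B(Z) = D(Z)` ⟹ `B(B × Z) = D(B × Z)` (`B(B) = D(B)` is gen 31's `AVSlots.isDivisorGenerated_of_finrank_hodgeLie_le_three`,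
  the span is gen 34's `AVSlots.hodgeClassesProductSpan_prod_of_finrank_hodgeLie_le_three_of_isOfCMType`).
* §3 powers: `isDivisorGenerated_powSucc_prod_powSucc_…_of_isOfCMType` (`A^{N+1} × C^{N+1}` from `B(C^{N+1}) = D`),
  **`isStablyNondegenerate_prod_of_finrank_hodgeLie_le_three_of_isOfCMType`** (`C` of CM type and stably nondegenerate ⟹
  `A × C` stably nondegenerate, with all mixed powers `A^{M+1} × C^{N+1}`), and UNCONDITIONALLY for a CM elliptic curve `E`
  (Tate–Murasaki `B(E^{N+1}) = D`, the tree's `EllipticCurve.hodgeClasses_divisorial_powSucc`):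
  **`isStablyNondegenerate_prod_of_finrank_hodgeLie_le_three_of_cmCurve`** — `A × E` satisfies condition (D)
  (Moonen–Zarhin (3.8)–(3.9) for `X` of Type II(1): `B•((X × E)ⁿ) = D•`), `isDivisorGenerated_powSucc_prod_powSucc_…_of_cmCurve`.

The named fact `Hazama1989_stablyNondegenerate_prod` (`StablyNondegenerateProducts`, case (1) of Thm. (3.2): no type-IV
factor on EITHER side) is not touched; case (2) is what is proved here, on the class where the tree computes `Lie Hg(A)`.

## References
* [MoonenZarhin1999LowDim] B. Moonen, Yu. Zarhin, Math. Ann. 315 (1999) 711–733, §2 condition (D), §3 first paragraph,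
  Thm. (3.2)(2), (3.8)–(3.9) [corpus: paper:arxiv-math_9901113 p. 4, p. 6]. [cite: MoonenZarhin1999LowDim, §3 Thm. (3.2)(2)]
* [Hazama1989] F. Hazama, Duke Math. J. 58 (1989) 31–37 (= Gordon 7.6.2). [cite: Hazama1989, Thm. (= Gordon 7.6.2)]
* [Gordon1999HodgeAVSurvey] B. B. Gordon, App. B of Lewis (1999), Thm. 7.5, Def. 7.6, Thm. 7.6.2. [cite: Gordon1999HodgeAVSurvey, Thm. 7.5 and Def. 7.6]
* [vanGeemen1994HodgeAV] B. van Geemen, LNM 1594 (1994), §2.4–2.5, Lemma 3.7, Thm. 4.3. [cite: vanGeemen1994HodgeAV, §2.4–2.5 and Thm. 4.3]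
* [Lombardo2016] D. Lombardo, Ann. Inst. Fourier 66 (2016), Lemma 3.4 (p. 1229). [cite: Lombardo2016, Lemma 3.4 (p. 1229)]
* [MumfordAV1970] D. Mumford, *Abelian Varieties*, §19 (`Hom(C, A × B) = Hom(C, A) ⊕ Hom(C, B)`). [cite: MumfordAV1970, §19]
* [HatcherAT2002] A. Hatcher, *Algebraic Topology*, §3.2 Prop. 3.10, Thm. 3.16. [cite: HatcherAT2002, §3.2 Thm. 3.16]
-/

noncomputable section

open CategoryTheory MonoidalCategory CartesianMonoidalCategory Module

namespace Literature.AlgebraicGeometry.HodgeTheory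

open Literature.AlgebraicTopology.SingularHomology
open Literature.AlgebraicGeometry.Motives
open Literature.Barriers.HodgeConjecture
open Literature.AlgebraicGeometry.Motives.HodgeStructure
open Literature.AlgebraicGeometry.Milne1999

/-! ### §1 Product span and `B = D` on the factors give `B = D` on the product (Moonen–Zarhin (3.8), §3) -/

section ProductSpanDivisor

variable (A C : AbelianVariety ℂ)

/-- **Exterior products of divisor polynomials are divisor polynomials**: if `B(A) = D(A)` and `B(C) = D(C)`, every
exterior product `pr_A^* a ⌣ pr_C^* b` of rational Hodge classes (`hodgeProductClasses A C p`) lies in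
`Dᵖ(A × C) ⊗ ℂ = divisorClassesSpan (A.X ⊗ C.X) (dim A + dim C) p` (pull-backs of products of divisor classes are products
of divisor classes, and `Dˡ ⌣ Dᵏ ⊆ D^{l+k}`). [cite: MoonenZarhin1999LowDim, §3 (3.8)] [cite: vanGeemen1994HodgeAV, §2.4–2.5]
[cite: HatcherAT2002, §3.2 Prop. 3.10] -/
theorem hodgeProductClasses_subset_divisorClassesSpan (hA : IsDivisorGenerated A) (hC : IsDivisorGenerated C) (p : ℕ) :
    hodgeProductClasses A C p ⊆ (divisorClassesSpan (A.X ⊗ C.X) (A.dim + C.dim) p : Set _) := by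
  rintro x ⟨l, k, hlk, a, b, ha, ha', hb, hb', rfl⟩
  have hAsp : IsSmoothProjective A.dim A.X := AbelianVariety.isSmoothProjective_holds
  have hCsp : IsSmoothProjective C.dim C.X := AbelianVariety.isSmoothProjective_holds
  have hACsp : IsSmoothProjective (A.dim + C.dim) (A.X ⊗ C.X) := IsSmoothProjective.tensor_holds hAsp hCsp
  exact cupProduct_mem_divisorClassesSpan_of_mem (by omega) hlk
    (map_mem_divisorClassesSpan hACsp hAsp (fst A.X C.X) (hA l a ha ha'))
    (map_mem_divisorClassesSpan hACsp hCsp (snd A.X C.X) (hC k b hb hb'))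

/-- **Moonen–Zarhin (3.8) / §3: if `B(A × C)` is spanned by the classes coming from `B(A)` and `B(C)`, and `B(A) = D(A)`,
`B(C) = D(C)`, then `B(A × C) = D(A × C)`** — for ANY complex abelian varieties `A`, `C` (UNCONDITIONAL; the span hypothesis
`HodgeClassesProductSpan A C` is the tree's rendering of `Hg(A × C) = Hg(A) × Hg(C)` on Hodge classes).
[cite: MoonenZarhin1999LowDim, §3 (3.8) and Thm. (3.2)] [cite: vanGeemen1994HodgeAV, §2.4–2.5] -/
theorem isDivisorGenerated_prod_of_productSpan (hS : HodgeClassesProductSpan A C) (hA : IsDivisorGenerated A)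
    (hC : IsDivisorGenerated C) : IsDivisorGenerated (A.prod C) := by
  intro p c hc hpp
  rw [AbelianVariety.dim_prod] at hpp ⊢
  exact Submodule.span_le.2 (hodgeProductClasses_subset_divisorClassesSpan A C hA hC p) (hS p c hc hpp)

/-- **`(A × C)^{N+1}` is a retract of `A^{N+1} × C^{N+1}`**, so `B = D` descends from the latter to the former (the
regrouping `((a_r, c_r))_r ↦ ((a_r)_r, (c_r)_r)` and its inverse compose to the identity;
`IsDivisorGenerated.of_comp_eq_nsmul_id` with `n = 1`). [cite: MumfordAV1970, §19 (Hom(C, A × B) = Hom(C, A) ⊕ Hom(C, B))]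
[cite: vanGeemen1994HodgeAV, §2.4–2.5 and §3.6–3.7] -/
theorem isDivisorGenerated_powSucc_prod_of_isDivisorGenerated_prod_powSucc (N : ℕ)
    (h : IsDivisorGenerated ((A.powSucc N).prod (C.powSucc N))) : IsDivisorGenerated ((A.prod C).powSucc N) := by
  refine IsDivisorGenerated.of_comp_eq_nsmul_id
    (AbelianVariety.prodLift (powSuccMap (AbelianVariety.fst A C) N) (powSuccMap (AbelianVariety.snd A C) N))
    (powLift N fun r => AbelianVariety.prodLift (AbelianVariety.fst _ _ ≫ powProj A N r)
      (AbelianVariety.snd _ _ ≫ powProj C N r)) one_ne_zero ?_ h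
  rw [one_smul]
  refine pow_hom_ext _ fun r => ?_
  rw [Category.assoc, powLift_powProj, Category.id_comp]
  apply AbelianVariety.prod_hom_ext
  · rw [Category.assoc, AbelianVariety.prodLift_fst, ← Category.assoc, AbelianVariety.prodLift_fst, powSuccMap_powProj]
  · rw [Category.assoc, AbelianVariety.prodLift_snd, ← Category.assoc, AbelianVariety.prodLift_snd, powSuccMap_powProj]

/-- **Moonen–Zarhin §3, first paragraph, with (3.8): if for every `N` the Hodge ring `B(A^{N+1} × C^{N+1})` is spanned by the
classes coming from the two factors, and `A`, `C` satisfy condition (D), then `A × C` satisfies condition (D)**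
(`(A × C)^{N+1} ≼ A^{N+1} × C^{N+1}` and the previous two theorems). [cite: MoonenZarhin1999LowDim, §3 and Thm. (3.2)]
[cite: Gordon1999HodgeAVSurvey, Thm. 7.5 (1) and Def. 7.6] -/
theorem isStablyNondegenerate_prod_of_forall_productSpan_powSucc
    (hS : ∀ N : ℕ, HodgeClassesProductSpan (A.powSucc N) (C.powSucc N)) (hA : IsStablyNondegenerate A)
    (hC : IsStablyNondegenerate C) : IsStablyNondegenerate (A.prod C) := fun N =>
  isDivisorGenerated_powSucc_prod_of_isDivisorGenerated_prod_powSucc A C N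
    (isDivisorGenerated_prod_of_productSpan _ _ (hS N) (hA N) (hC N))

end ProductSpanDivisor

/-! ### §2 Moonen–Zarhin Thm. (3.2)(2) for the `𝔰𝔩₂`-isotypic class: `B(B × Z) = D(B × Z)` -/

section Slots

variable {A C B Z : AbelianVariety ℂ} {n : ℕ} {gA : Fin n → (B ⟶ A)} {gC : Fin n → (Z ⟶ C)}

/-- **Moonen–Zarhin 1999 Thm. (3.2)(2), PROVED for the `𝔰𝔩₂`-isotypic class.**  Let `A` be a complex abelian variety NOT of
CM type with `dim_ℚ Lie Hg(H¹A) ≤ 3` (a non-CM elliptic curve or an abelian surface with quaternionic multiplication: no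
factor of Type 4), `B` with `n` slots over `A`, `C` of CM type and `Z` with `n` slots over `C` satisfying `B(Z) = D(Z)`.
Then `B(B × Z) = D(B × Z)`: every rational `(p,p)`-class on `B × Z` is a polynomial in divisor classes — the product span
(gen 34, Lombardo 3.4 / Moonen–Zarhin (3.1)–(3.2)(2) on Hodge classes) with `B(B) = D(B)` (gen 31, Murty 1984 / Gordon 7.5)
and §1. [cite: MoonenZarhin1999LowDim, §3 Thm. (3.2)(2)] [cite: Lombardo2016, Lemma 3.4 (p. 1229)]
[cite: Gordon1999HodgeAVSurvey, Thm. 7.5 and §7.3.2] -/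
theorem AVSlots.isDivisorGenerated_prod_of_finrank_hodgeLie_le_three_of_isOfCMType [HodgeTensorFacts.{0, 0}]
    (hB : AVSlots A B gA) (hZ : AVSlots C Z gC)
    (hne : haveI := BettiUniverse.finite (AbelianVariety.isSmoothProjective_holds (A := A)) 1
      ¬ (BettiUniverse.hodge exists_isReal_hodgeModel_holds (AbelianVariety.isSmoothProjective_holds (A := A)) 1).hodgeLie
        ≤ Subalgebra.toSubmodule
          (BettiUniverse.hodge exists_isReal_hodgeModel_holds (AbelianVariety.isSmoothProjective_holds (A := A)) 1).endAlg)
    (h3 : haveI := BettiUniverse.finite (AbelianVariety.isSmoothProjective_holds (A := A)) 1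
      Module.finrank ℚ (BettiUniverse.hodge exists_isReal_hodgeModel_holds
        (AbelianVariety.isSmoothProjective_holds (A := A)) 1).hodgeLie ≤ 3)
    (hC : Milne1999.IsOfCMType C) (hZD : IsDivisorGenerated Z) : IsDivisorGenerated (B.prod Z) :=
  isDivisorGenerated_prod_of_productSpan B Z
    (hB.hodgeClassesProductSpan_prod_of_finrank_hodgeLie_le_three_of_isOfCMType hZ hne h3 hC)
    (hB.isDivisorGenerated_of_finrank_hodgeLie_le_three hne h3) hZD

/-- **The binder shape of Moonen–Zarhin Thm. (3.2)(2) / Hazama on condition (D), discharged on this class**: with `B`, `Z`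
as above the instance `HasNoTypeIVFactor B → IsOfCMType Z → IsDivisorGenerated B → IsDivisorGenerated Z →
IsDivisorGenerated (B × Z)` holds (the first three hypotheses are not used: `Hg(B) = SL₂` acts isotypically and `B(B) = D(B)`
is a theorem). [cite: MoonenZarhin1999LowDim, §3 Thm. (3.2)(2)] [cite: Hazama1989, Thm. (= Gordon 7.6.2)] -/
theorem AVSlots.moonenZarhin_3_2_2_of_finrank_hodgeLie_le_three [HodgeTensorFacts.{0, 0}]
    (hB : AVSlots A B gA) (hZ : AVSlots C Z gC)
    (hne : haveI := BettiUniverse.finite (AbelianVariety.isSmoothProjective_holds (A := A)) 1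
      ¬ (BettiUniverse.hodge exists_isReal_hodgeModel_holds (AbelianVariety.isSmoothProjective_holds (A := A)) 1).hodgeLie
        ≤ Subalgebra.toSubmodule
          (BettiUniverse.hodge exists_isReal_hodgeModel_holds (AbelianVariety.isSmoothProjective_holds (A := A)) 1).endAlg)
    (h3 : haveI := BettiUniverse.finite (AbelianVariety.isSmoothProjective_holds (A := A)) 1
      Module.finrank ℚ (BettiUniverse.hodge exists_isReal_hodgeModel_holds
        (AbelianVariety.isSmoothProjective_holds (A := A)) 1).hodgeLie ≤ 3)
    (hC : Milne1999.IsOfCMType C) :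
    HasNoTypeIVFactor B → Milne1999.IsOfCMType Z → IsDivisorGenerated B → IsDivisorGenerated Z →
      IsDivisorGenerated (B.prod Z) :=
  fun _ _ _ hZD => hB.isDivisorGenerated_prod_of_finrank_hodgeLie_le_three_of_isOfCMType hZ hne h3 hC hZD

end Slots

/-! ### §3 Powers: `A^{N+1} × C^{N+1}`; `A × C` is stably nondegenerate when `C` is; unconditionally for a CM elliptic curve -/

section Powers

variable {A C : AbelianVariety ℂ}

/-- **`B(A^{N+1} × C^{N+1}) = D` from `B(C^{N+1}) = D`** for `A` NOT of CM type with `dim_ℚ Lie Hg(H¹A) ≤ 3` and `C` of CM type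
(§2 with the power slots `avPowSlots`). [cite: MoonenZarhin1999LowDim, §3 Thm. (3.2)(2)] [cite: Gordon1999HodgeAVSurvey, Thm. 7.5 and §7.3.2] -/
theorem isDivisorGenerated_powSucc_prod_powSucc_of_finrank_hodgeLie_le_three_of_isOfCMType [HodgeTensorFacts.{0, 0}]
    (hne : haveI := BettiUniverse.finite (AbelianVariety.isSmoothProjective_holds (A := A)) 1
      ¬ (BettiUniverse.hodge exists_isReal_hodgeModel_holds (AbelianVariety.isSmoothProjective_holds (A := A)) 1).hodgeLie
        ≤ Subalgebra.toSubmodule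
          (BettiUniverse.hodge exists_isReal_hodgeModel_holds (AbelianVariety.isSmoothProjective_holds (A := A)) 1).endAlg)
    (h3 : haveI := BettiUniverse.finite (AbelianVariety.isSmoothProjective_holds (A := A)) 1
      Module.finrank ℚ (BettiUniverse.hodge exists_isReal_hodgeModel_holds
        (AbelianVariety.isSmoothProjective_holds (A := A)) 1).hodgeLie ≤ 3)
    (hC : Milne1999.IsOfCMType C) (N : ℕ) (hD : IsDivisorGenerated (C.powSucc N)) :
    IsDivisorGenerated ((A.powSucc N).prod (C.powSucc N)) :=
  (AVSlots.powSucc A N).isDivisorGenerated_prod_of_finrank_hodgeLie_le_three_of_isOfCMType (AVSlots.powSucc C N) hne h3 hC hD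

/-- **Moonen–Zarhin Thm. (3.2)(2) as condition (D): `A × C` is stably nondegenerate** for `A` NOT of CM type with
`dim_ℚ Lie Hg(H¹A) ≤ 3` and `C` of CM type satisfying condition (D) (`IsStablyNondegenerate C`): every power
`(A × C)^{N+1} ≼ A^{N+1} × C^{N+1}` has `B = D`. [cite: MoonenZarhin1999LowDim, §3 Thm. (3.2)(2)]
[cite: Gordon1999HodgeAVSurvey, Thm. 7.5 (1), Def. 7.6 and Thm. 7.6.2] -/
theorem isStablyNondegenerate_prod_of_finrank_hodgeLie_le_three_of_isOfCMType [HodgeTensorFacts.{0, 0}]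
    (hne : haveI := BettiUniverse.finite (AbelianVariety.isSmoothProjective_holds (A := A)) 1
      ¬ (BettiUniverse.hodge exists_isReal_hodgeModel_holds (AbelianVariety.isSmoothProjective_holds (A := A)) 1).hodgeLie
        ≤ Subalgebra.toSubmodule
          (BettiUniverse.hodge exists_isReal_hodgeModel_holds (AbelianVariety.isSmoothProjective_holds (A := A)) 1).endAlg)
    (h3 : haveI := BettiUniverse.finite (AbelianVariety.isSmoothProjective_holds (A := A)) 1
      Module.finrank ℚ (BettiUniverse.hodge exists_isReal_hodgeModel_holds
        (AbelianVariety.isSmoothProjective_holds (A := A)) 1).hodgeLie ≤ 3)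
    (hC : Milne1999.IsOfCMType C) (hCs : IsStablyNondegenerate C) : IsStablyNondegenerate (A.prod C) := fun N =>
  isDivisorGenerated_powSucc_prod_of_isDivisorGenerated_prod_powSucc A C N
    (isDivisorGenerated_powSucc_prod_powSucc_of_finrank_hodgeLie_le_three_of_isOfCMType hne h3 hC N (hCs N))

/-- **All mixed powers `A^{M+1} × C^{N+1}` are stably nondegenerate** under the same hypotheses (retracts of powers of
`A × C`, the tree's `IsStablyNondegenerate.powSucc_prod_powSucc`). [cite: MoonenZarhin1999LowDim, §3 Thm. (3.2)(2)]
[cite: Gordon1999HodgeAVSurvey, Def. 7.6 and Thm. 7.6.2] -/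
theorem isStablyNondegenerate_powSucc_prod_powSucc_of_finrank_hodgeLie_le_three_of_isOfCMType [HodgeTensorFacts.{0, 0}]
    (hne : haveI := BettiUniverse.finite (AbelianVariety.isSmoothProjective_holds (A := A)) 1
      ¬ (BettiUniverse.hodge exists_isReal_hodgeModel_holds (AbelianVariety.isSmoothProjective_holds (A := A)) 1).hodgeLie
        ≤ Subalgebra.toSubmodule
          (BettiUniverse.hodge exists_isReal_hodgeModel_holds (AbelianVariety.isSmoothProjective_holds (A := A)) 1).endAlg)
    (h3 : haveI := BettiUniverse.finite (AbelianVariety.isSmoothProjective_holds (A := A)) 1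
      Module.finrank ℚ (BettiUniverse.hodge exists_isReal_hodgeModel_holds
        (AbelianVariety.isSmoothProjective_holds (A := A)) 1).hodgeLie ≤ 3)
    (hC : Milne1999.IsOfCMType C) (hCs : IsStablyNondegenerate C) (M N : ℕ) :
    IsStablyNondegenerate ((A.powSucc M).prod (C.powSucc N)) :=
  (isStablyNondegenerate_prod_of_finrank_hodgeLie_le_three_of_isOfCMType hne h3 hC hCs).powSucc_prod_powSucc M N

/-- **Every power of a complex elliptic curve has `B = D`** (Tate 1965, Murasaki; van Geemen Thm. 4.3): an elliptic curve is
stably nondegenerate (the tree's `EllipticCurve.hodgeClasses_divisorial_powSucc`, restated as condition (D)).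
[cite: vanGeemen1994HodgeAV, Thm. 4.3] [cite: MoonenZarhin1999LowDim, (2.1) and Cor. (3.9)] -/
theorem EllipticCurve.isStablyNondegenerate {E : AbelianVariety ℂ} (hE : E.dim = 1) : IsStablyNondegenerate E :=
  fun N p c hcQ hc => EllipticCurve.hodgeClasses_divisorial_powSucc hE N p c hcQ hc

/-- **UNCONDITIONAL: `B(A^{N+1} × E^{N+1}) = D(A^{N+1} × E^{N+1}) ⊗ ℂ`** for `A` NOT of CM type with `dim_ℚ Lie Hg(H¹A) ≤ 3`
(a non-CM elliptic curve or a QM abelian surface) and `E` an elliptic curve with complex multiplication — the Hodge group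
`SL₂ × U(1)` of Moonen–Zarhin; strengthens gen 34's `hodgeConjectureFor_powSucc_prod_powSucc_of_finrank_hodgeLie_le_three_of_cmCurve`
from HC to divisor generation. [cite: MoonenZarhin1999LowDim, §2 (2.1)–(2.2), §3 Thm. (3.2)(2) and (3.8)–(3.9)]
[cite: vanGeemen1994HodgeAV, Thm. 4.3] [cite: Gordon1999HodgeAVSurvey, Thm. 7.5 and §7.3.2] -/
theorem isDivisorGenerated_powSucc_prod_powSucc_of_finrank_hodgeLie_le_three_of_cmCurve [HodgeTensorFacts.{0, 0}]
    (hne : haveI := BettiUniverse.finite (AbelianVariety.isSmoothProjective_holds (A := A)) 1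
      ¬ (BettiUniverse.hodge exists_isReal_hodgeModel_holds (AbelianVariety.isSmoothProjective_holds (A := A)) 1).hodgeLie
        ≤ Subalgebra.toSubmodule
          (BettiUniverse.hodge exists_isReal_hodgeModel_holds (AbelianVariety.isSmoothProjective_holds (A := A)) 1).endAlg)
    (h3 : haveI := BettiUniverse.finite (AbelianVariety.isSmoothProjective_holds (A := A)) 1
      Module.finrank ℚ (BettiUniverse.hodge exists_isReal_hodgeModel_holds
        (AbelianVariety.isSmoothProjective_holds (A := A)) 1).hodgeLie ≤ 3)
    {E : AbelianVariety ℂ} (hE : E.dim = 1) (hEcm : Milne1999.IsOfCMType E) (N : ℕ) :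
    IsDivisorGenerated ((A.powSucc N).prod (E.powSucc N)) :=
  isDivisorGenerated_powSucc_prod_powSucc_of_finrank_hodgeLie_le_three_of_isOfCMType hne h3 hEcm N
    (EllipticCurve.isStablyNondegenerate hE N)

/-- **UNCONDITIONAL, Moonen–Zarhin (3.8)–(3.9) for Type II(1) and Thm. (3.2)(2): `A × E` satisfies condition (D)** —
`B•((A × E)^{N+1}) = D•((A × E)^{N+1}) ⊗ ℂ` for every `N`, for `A` NOT of CM type with `dim_ℚ Lie Hg(H¹A) ≤ 3` and `E` a CM
elliptic curve; in Gordon's language `A × E` is stably nondegenerate. [cite: MoonenZarhin1999LowDim, §3 Thm. (3.2)(2) and (3.8)–(3.9)]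
[cite: Gordon1999HodgeAVSurvey, Thm. 7.5 (1), Def. 7.6] [cite: vanGeemen1994HodgeAV, Thm. 4.3] -/
theorem isStablyNondegenerate_prod_of_finrank_hodgeLie_le_three_of_cmCurve [HodgeTensorFacts.{0, 0}]
    (hne : haveI := BettiUniverse.finite (AbelianVariety.isSmoothProjective_holds (A := A)) 1
      ¬ (BettiUniverse.hodge exists_isReal_hodgeModel_holds (AbelianVariety.isSmoothProjective_holds (A := A)) 1).hodgeLie
        ≤ Subalgebra.toSubmodule
          (BettiUniverse.hodge exists_isReal_hodgeModel_holds (AbelianVariety.isSmoothProjective_holds (A := A)) 1).endAlg)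
    (h3 : haveI := BettiUniverse.finite (AbelianVariety.isSmoothProjective_holds (A := A)) 1
      Module.finrank ℚ (BettiUniverse.hodge exists_isReal_hodgeModel_holds
        (AbelianVariety.isSmoothProjective_holds (A := A)) 1).hodgeLie ≤ 3)
    {E : AbelianVariety ℂ} (hE : E.dim = 1) (hEcm : Milne1999.IsOfCMType E) : IsStablyNondegenerate (A.prod E) :=
  isStablyNondegenerate_prod_of_finrank_hodgeLie_le_three_of_isOfCMType hne h3 hEcm (EllipticCurve.isStablyNondegenerate hE)

/-- **… and every mixed power `A^{M+1} × E^{N+1}` is stably nondegenerate** (UNCONDITIONAL).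
[cite: MoonenZarhin1999LowDim, §3 Thm. (3.2)(2) and (3.8)–(3.9)] [cite: Gordon1999HodgeAVSurvey, Def. 7.6] -/
theorem isStablyNondegenerate_powSucc_prod_powSucc_of_finrank_hodgeLie_le_three_of_cmCurve [HodgeTensorFacts.{0, 0}]
    (hne : haveI := BettiUniverse.finite (AbelianVariety.isSmoothProjective_holds (A := A)) 1
      ¬ (BettiUniverse.hodge exists_isReal_hodgeModel_holds (AbelianVariety.isSmoothProjective_holds (A := A)) 1).hodgeLie
        ≤ Subalgebra.toSubmodule
          (BettiUniverse.hodge exists_isReal_hodgeModel_holds (AbelianVariety.isSmoothProjective_holds (A := A)) 1).endAlg)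
    (h3 : haveI := BettiUniverse.finite (AbelianVariety.isSmoothProjective_holds (A := A)) 1
      Module.finrank ℚ (BettiUniverse.hodge exists_isReal_hodgeModel_holds
        (AbelianVariety.isSmoothProjective_holds (A := A)) 1).hodgeLie ≤ 3)
    {E : AbelianVariety ℂ} (hE : E.dim = 1) (hEcm : Milne1999.IsOfCMType E) (M N : ℕ) :
    IsStablyNondegenerate ((A.powSucc M).prod (E.powSucc N)) :=
  (isStablyNondegenerate_prod_of_finrank_hodgeLie_le_three_of_cmCurve hne h3 hE hEcm).powSucc_prod_powSucc M N

end Powers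

end Literature.AlgebraicGeometry.HodgeTheory

end
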